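import Literature.MathematicalPhysics.QuantumFieldTheory.Balaban1983to89.B8LeafKnitRSC
import Literature.MathematicalPhysics.QuantumFieldTheory.Balaban1983to89.B8Thm2ZdGF3P2MapGammaPrime

/-!
# `Balaban1983to89.B8LeafKnitZdGF3P2GammaPrime` — [Balaban1985RegularSpaces] THE RE-TYPED B8 LEAF IN THE «P₂C» SHAPE `B8LeafKnitRSC.B8LeafRSC` (Lemma 1 p. 79 –
# Theorem 8 p. 101; Prop. 7 in the repaired-constant currency `B8Ineq145.Prop7RepairedC C₇`) ON ANY INDEX-MAPPED `Ω₀ = ℤᵈ` SUB-FAMILY OF THE EDITION-δ₂ P-CARRIER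
# `B8LeafModelZd3P2.zdGF3HP₂` OVER THE γ′ SOCKET FAMILY OF RECORD — the (D6₂) item of dag-n05-d g11's DESIGN «P₂C» (cell bus 2026-08-28 03:12Z ∕ WORD-3 03:24Z):
# the token image of this seat's g0 `B8LeafKnitZdGF3PGammaPrime.b8LeafRS_zdGF3HP_mapJ_γ'` (p596146) — `l1` kernel, `t2 := thm2Printed_zdGF3HP₂_mapJ_γ'` (D5₂),
# `t4 :=` g0's `thm4Printed_zdGF3HP_mapJ_γ'` through dag-n05-d's `Iff.rfl` transfer `thm4Printed_zdGF3HP₂_iff`, `p3 := hP3` on `zdGF3P₂ ∘ ι` (dag-n05-d's D3₂),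
# `p5e p5u p6 t8` displayed, and `p7` displayed IN THE REPAIRED CURRENCY (served at NODE 00's admissible members by n05-w1's `…RecordP` faces ∕ this seat's
# `B8Prop7TowerAxialAdmissible`, through `prop7RepairedC_zdGF3HP₂_iff`)

statement-level skeleton of published theorems with citation tags; proofs where landed; nothing here is a claim about the Yang–Mills mass gap

T. Bałaban, *Spaces of regular gauge field configurations on a lattice and gauge fixing conditions*, Commun. Math. Phys. **99** (1985) 75–102
`[Balaban1985RegularSpaces]` ("B8"; journal page = PDF page + 74): Lemma 1 p. 79, Thm 2 p. 83, Prop. 3 p. 87, Thm 4 p. 88, Props. 5–7 pp. 94–100, Thm 8 (1.146) p. 101,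
(1.36) p. 82, p. 77.  [4] = `[Balaban1985BackgroundPropagators]`, (3.40) p. 397.

## WHY THIS FILE (cell `pub-ymgap`, HUMAN RULING D-0062 ∕ D-0149; seat `pub-ymgap-dag-n05-w2` g2, WIDTH SEAT 2 of 4 on NODE n05 = [B8]; count-neutral)

DESIGN «P₂C» re-pins the N05 slot on (i) the admissible sub-index `IdxB8SubC`, (ii) the leaf shape `B8LeafRSC` with `p7 : Prop7RepairedC C₇` (dag-n05-d g11, `B8LeafKnitRSC`),
(iii) print's axial map pinned, over the δ₂ carrier `zdGF3HP₂` ((1.36)'s Hölder member both-points, [4] (3.40)).  dag-n05-d's WORD-3 divides the knit: THIS FILE is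
this seat's leaf assembly (b) — the nine fields of `B8LeafRSC` on `zdGF3HP₂ ∘ ι` with four of them kernel instances ∕ transfers (`l1 t2 p3 t4`), the rest displayed
in the binder texts of g0's p596146 with the δ₂ tokens; dag-n05-d's D9b₂C books it at the record's cut layer.

## HONEST SCOPE

Assembly BY NAME; no estimate; every socket ∕ zero source ∕ tower law ∕ `hP3` ∕ `p5e p5u p6 p7 t8` is a HYPOTHESIS (providers: n05-w4's γ′ chain, dag-n05-d's D3₂ ∕ D7₂ ∕
zdLan ∕ cutSubBP, n05-w1's admissible-member Prop-7 faces; [4]'s letters and the both-points b9 socket = N06 content, OPEN; no joint-satisfiability claim);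
`C₇` is a free letter here (the slot pins `530·θ.D·θ.L²`).  `d, L ≥ 2`; `T_η ↦ ℤᵈ`.  Count-neutral; N05 NOT discharged; no count claim (the chair's single count
line is the only count); one finite `𝕋⁴` programme at fixed `ε`, Bałaban AS PRINTED; the Yang–Mills mass gap (Clay) is NOT proved by any of this — R4 closes the
conditional finite-𝕋⁴ rung `BalabanLadder.UV` only; nothing continuum ∕ ℝ⁴ ∕ OS.  No `sorry`, no `def`, no `instance`, no `notation`.  Unit `pub-ymgap-dag-n05-w2` (g2),
2026-08-28.

RELATED, NOT DUPLICATED: `B8LeafKnitZdGF3PGammaPrime` (g0: the δ₁ ∕ `B8LeafRS` edition — this is its token image), `B8LeafKnitRSC` (dag-n05-d: the shape, USED),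
`B8Thm2ZdGF3P2MapGammaPrime` (this seat: D5₂, USED), `B8LeafModelZd3P2` (dag-n05-d: carrier + transfers, USED).

[cite: Balaban1985RegularSpaces, Lemma 1 p.79, Thm 2 p.83, Prop. 3 p.87, Thm 4 p.88, Prop. 5 p.94, Prop. 6 p.99, Prop. 7 p.100, Thm 8 p.101, (1.36) p.82, p.77; Balaban1985BackgroundPropagators, (3.40) p.397]
-/

noncomputable section

namespace Literature.MathematicalPhysics.QuantumFieldTheory.Balaban1983to89.B8LeafKnitZdGF3P2GammaPrime

open B7Prop1Explicit B7Prop2Explicit B7Prop1Local B7Eq92Concrete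
open B7Prop2Explicit (unitaryUnits)
open B7Prop4GeneralLevels (linCovIter)
open B8Ineq132 (covDerivFwd InAk)
open B8Eq119TwistedAxial (Restr129 InAx)
open B8Eq184Proof (gaugeExp cfgExp)
open B8Lemma1NonAbelian (mulCfg blockPairNA lemma1Printed_blockPairNA)
open B8Eq140Level (SideTouches)
open B8Eq146AExpansion (iEta)
open B8Eq155JBound (Jcur wsup)
open B8ScaledSupNorm (bondNorm msup)
open B8Ineq130 (tlo thi)
open B8Eq138LandauZd (IsLandau138W)
open B8LeafKnitRSC (B8LeafRSC)
open B8LeafModelZd (ZdIdx)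
open B8LeafModelZd3P (zdGF3P zdGF3HP)
open B8LeafModelZd3P2 (zdGF3P₂ zdGF3HP₂ thm4Printed_zdGF3HP₂_iff)
open B8TowerBondsPrinted (towerBondsP)
open B8Thm4ZdGF3PMapGammaPrime (thm4Printed_zdGF3HP_mapJ_γ')
open B8Thm2ZdGF3P2MapGammaPrime (thm2Printed_zdGF3HP₂_mapJ_γ')

-- `Site` alone could resolve to the torus sites of `Setup.lean`; re-export the `ℤ^d` sites of `B7Prop1Explicit`.
export B7Prop1Explicit (Site)

variable {d : ℕ}

section Knit

variable {𝔸 : Type} [CStarAlgebra 𝔸] [Nontrivial 𝔸]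
variable {I₃ I₄ : Type} {lan : I₃ → B8.LandauData} {cub : I₄ → B8.CubeData}

/-- ★★ **THE RE-TYPED B8 LEAF ON AN INDEX-MAPPED `Ω₀ = ℤᵈ` SUB-FAMILY OF THE P-CARRIER `zdGF3HP`, γ′ SOCKET FAMILY, ZERO SOURCE — FOUR CONJUNCTS BY KERNEL
INSTANCES.**  For `d, L ≥ 2`, the leaf's `inp : B9Inputs`, `B₀β > 0`, Prop. 5's radius `cu > 0` and the providers' threshold `cP > 0`, source constants
`γ′ ≥ 0`, `B₈ ≥ inp.B₀` with `5dL·inp.B₀ + 2γ′·inp.B₀ ≤ 5dL·B₈`, `2 ≤ 5dL·B₈`, a (1.61)-constant `C₂ ≤ 2097152(d+1)²L²`, any Hölder data `β, len`, any block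
size `Lb`; the γ′ socket family of record ALONG `ι` (dag-n05-d's `thm4Core_zdGF3HP_map_lanE_γ'` binders: source data `Φ, Adm a, LanF a`, the four sourced sockets AT `ι a`
with the carrier's one-end-point (1.35) antecedent, at `B₀ := inp.B₀`, `B₀′ := inp.B₀′`), a zero source `(φ₀, hAdm₀, hLan₀)`; PROPOSITION 3 on the image family `zdGF3P ∘ ι` as one
hypothesis `hP3`; an index map `ι : J → ZdIdx d L` into `Ω₀ = ℤᵈ` members with their tower laws at every truncation; and the five remaining printed statements
as hypotheses (`p7` in the `Prop7RepairedC C₇` currency): `B8LeafRSC d L C₂ (5dL·B₈) inp.B₀′ B₁ B₂ c₁ inp B₀β C₇ (blockPairNA d Lb 𝔸) (zdGF3HP₂ ∘ ι) lan cub toAxial` with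
`l1 := lemma1Printed_blockPairNA`, `t2 := thm2Printed_zdGF3HP₂_mapJ_γ'` (D5₂), `p3 := hP3` (Prop. 3 on the IMAGE family, δ₂), `t4 :=` g0's `thm4Printed_zdGF3HP_mapJ_γ'` through
`thm4Printed_zdGF3HP₂_iff` (`Iff.rfl`).
[cite: Balaban1985RegularSpaces, Lemma 1 p.79, Thm 2 p.83, Prop. 3 p.87, Thm 4 p.88 (kernel instances ∕ `hP3`); Prop. 5 p.94, Prop. 6 p.99, Prop. 7 p.100, Thm 8 p.101 (named hypotheses); p.77] -/
theorem b8LeafRSC_zdGF3HP₂_mapJ_γ' (hd2 : 2 ≤ d) {L : ℕ} (hL : 2 ≤ L) (Lb : ℕ) (β : ℝ) (len : Site d → ℝ) (inp : B8.B9Inputs)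
    {B₀β C₂ cu cP B₁ B₂ c₁ : ℝ} (C₇ : ℝ) (hB₀β : 0 < B₀β) (hC₂ : C₂ ≤ 2097152 * ((d : ℝ) + 1) ^ 2 * (L : ℝ) ^ 2) (hcu : 0 < cu) (hcP : 0 < cP)
    {Φ : Type*} {γ' B₈ : ℝ} (hγ' : 0 ≤ γ') (hB₈ : 0 < B₈) (hB₀8 : inp.B₀ ≤ B₈) (hB : 2 ≤ 5 * (d : ℝ) * L * B₈)
    (hγB : 5 * (d : ℝ) * L * inp.B₀ + 2 * (γ' * inp.B₀) ≤ 5 * (d : ℝ) * L * B₈)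
    {J : Type} (ι : J → ZdIdx d L)
    (Adm : J → Φ → (Site d → Fin d → 𝔸ˣ) → ℝ → ℝ → Prop)
    (LanF : J → (Site d → Fin d → 𝔸ˣ) → Φ → ℕ → (Site d → Fin d → 𝔸ˣ) → Prop)
    (SP5base : ∀ a : J, ∀ α₀ α₁ : ℝ, 0 < α₀ → 0 < α₁ → α₀ + α₁ ≤ cP →
      ∀ U₀ U' : Site d → Fin d → 𝔸ˣ, (∀ x κ, U₀ x κ ∈ unitaryUnits 𝔸) → (∀ x κ, U' x κ ∈ unitaryUnits 𝔸) →
      ∀ φ : Φ, Adm a φ U₀ α₀ α₁ →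
      InAk L (ι a).k (ι a).η α₀ (ι a).Ω U₀ → InAk L (ι a).k (ι a).η α₀ (ι a).Ω (mulCfg U' U₀) → (∀ m, m ≤ (ι a).k → InAx L m ((ι a).Λs m) U₀ (mulCfg U' U₀)) →
      (∀ j, j ≤ (ι a).k → ∀ (z : Site d) (μ : Fin d),
        ((∀ x, InBox (tlo L z j) (thi L z j) x → x ∈ (ι a).Ω j) ∨ (∀ x, InBox (tlo L (z + e μ) j) (thi L (z + e μ) j) x → x ∈ (ι a).Ω j)) →
        ‖(avgIter L (mulCfg U' U₀) j z μ : 𝔸) - (avgIter L U₀ j z μ : 𝔸)‖ ≤ α₁) →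
      (∀ b ∈ {b : Site d × Fin d | SideTouches ((ι a).Ω 0) b.1 b.2}, ‖((U' b.1 b.2 : 𝔸ˣ) : 𝔸) - 1‖ ≤ α₁) →
      (∃ (v : Site d → 𝔸ˣ) (lam : Site d → 𝔸), (∀ x, v x ∈ unitaryUnits 𝔸) ∧ (∀ x, x ∉ (ι a).Ω 0 → v x = 1) ∧
        (∀ j, j ≤ 1 → ∀ b ∈ {b : Site d × Fin d | SideTouches ((ι a).Ω j) b.1 b.2}, (v b.1 : 𝔸) = ((gaugeExp lam b.1 : 𝔸ˣ) : 𝔸) ∧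
        (v (b.1 + e b.2) : 𝔸) = ((gaugeExp lam (b.1 + e b.2) : 𝔸ˣ) : 𝔸)) ∧
        (∀ j, j ≤ 1 → ∀ b ∈ {b : Site d × Fin d | SideTouches ((ι a).Ω j) b.1 b.2},
        ‖lam b.1‖ ≤ (8 * inp.B₀' * (5 * (d : ℝ) * L * B₈) * (α₀ + α₁)) ∧ ((L : ℝ) ^ j * (ι a).η) * ‖covDerivFwd (ι a).η U₀ b.2 lam b.1‖ ≤ (8 * inp.B₀' * (5 * (d : ℝ) * L * B₈) * (α₀ + α₁))) ∧
        LanF a U₀ φ 1 (mgauge U₀ v⁻¹ U') ∧ Restr129 L 1 ((ι a).Λs 1) U₀ ((1 : Site d → 𝔸ˣ) * v)))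
    (SP5 : ∀ a : J, ∀ α₀ α₁ : ℝ, 0 < α₀ → 0 < α₁ → α₀ + α₁ ≤ cP →
      ∀ U₀ U' : Site d → Fin d → 𝔸ˣ, (∀ x κ, U₀ x κ ∈ unitaryUnits 𝔸) → (∀ x κ, U' x κ ∈ unitaryUnits 𝔸) →
      ∀ φ : Φ, Adm a φ U₀ α₀ α₁ →
      InAk L (ι a).k (ι a).η α₀ (ι a).Ω U₀ → InAk L (ι a).k (ι a).η α₀ (ι a).Ω (mulCfg U' U₀) → (∀ m, m ≤ (ι a).k → InAx L m ((ι a).Λs m) U₀ (mulCfg U' U₀)) →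
      (∀ j, j ≤ (ι a).k → ∀ (z : Site d) (μ : Fin d),
        ((∀ x, InBox (tlo L z j) (thi L z j) x → x ∈ (ι a).Ω j) ∨ (∀ x, InBox (tlo L (z + e μ) j) (thi L (z + e μ) j) x → x ∈ (ι a).Ω j)) →
        ‖(avgIter L (mulCfg U' U₀) j z μ : 𝔸) - (avgIter L U₀ j z μ : 𝔸)‖ ≤ α₁) →
      (∀ b ∈ {b : Site d × Fin d | SideTouches ((ι a).Ω 0) b.1 b.2}, ‖((U' b.1 b.2 : 𝔸ˣ) : 𝔸) - 1‖ ≤ α₁) →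
      (∀ m, 1 ≤ m → m < (ι a).k → ∀ (u₁ : Site d → 𝔸ˣ) (U₁ : Site d → Fin d → 𝔸ˣ) (A : Site d → Fin d → 𝔸),
        (∀ x, u₁ x ∈ unitaryUnits 𝔸) → (∀ x, x ∉ (ι a).Ω 0 → u₁ x = 1) → mgauge U₀ u₁ U₁ = U' → Restr129 L m ((ι a).Λs m) U₀ u₁ →
        LanF a U₀ φ m U₁ →
        (∀ j, j ≤ m → ∀ b ∈ {b : Site d × Fin d | SideTouches ((ι a).Ω j) b.1 b.2},
        U₁ b.1 b.2 = cfgExp (ι a).η A b.1 b.2 ∧ IsSelfAdjoint (A b.1 b.2) ∧ ‖A b.1 b.2‖ ≤ (5 * (d : ℝ) * L * B₈ * (α₀ + α₁)) * ((L : ℝ) ^ j * (ι a).η)⁻¹) →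
        ∃ (v : Site d → 𝔸ˣ) (lam : Site d → 𝔸), (∀ x, v x ∈ unitaryUnits 𝔸) ∧ (∀ x, x ∉ (ι a).Ω 0 → v x = 1) ∧
        (∀ j, j ≤ m + 1 → ∀ b ∈ {b : Site d × Fin d | SideTouches ((ι a).Ω j) b.1 b.2}, (v b.1 : 𝔸) = ((gaugeExp lam b.1 : 𝔸ˣ) : 𝔸) ∧
        (v (b.1 + e b.2) : 𝔸) = ((gaugeExp lam (b.1 + e b.2) : 𝔸ˣ) : 𝔸)) ∧
        (∀ j, j ≤ m + 1 → ∀ b ∈ {b : Site d × Fin d | SideTouches ((ι a).Ω j) b.1 b.2},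
        ‖lam b.1‖ ≤ (8 * inp.B₀' * (5 * (d : ℝ) * L * B₈) * (α₀ + α₁)) ∧ ((L : ℝ) ^ j * (ι a).η) * ‖covDerivFwd (ι a).η U₀ b.2 lam b.1‖ ≤ (8 * inp.B₀' * (5 * (d : ℝ) * L * B₈) * (α₀ + α₁))) ∧
        LanF a U₀ φ (m + 1) (mgauge U₀ v⁻¹ U₁) ∧ Restr129 L (m + 1) ((ι a).Λs (m + 1)) U₀ (u₁ * v)))
    (SH59src : ∀ a : J, ∀ α₀ α₁ : ℝ, 0 < α₀ → 0 < α₁ → α₀ + α₁ ≤ cP →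
      ∀ U₀ U' : Site d → Fin d → 𝔸ˣ, (∀ x κ, U₀ x κ ∈ unitaryUnits 𝔸) → (∀ x κ, U' x κ ∈ unitaryUnits 𝔸) →
      ∀ φ : Φ, Adm a φ U₀ α₀ α₁ →
      InAk L (ι a).k (ι a).η α₀ (ι a).Ω U₀ → InAk L (ι a).k (ι a).η α₀ (ι a).Ω (mulCfg U' U₀) → (∀ m, m ≤ (ι a).k → InAx L m ((ι a).Λs m) U₀ (mulCfg U' U₀)) →
      (∀ j, j ≤ (ι a).k → ∀ (z : Site d) (μ : Fin d),
        ((∀ x, InBox (tlo L z j) (thi L z j) x → x ∈ (ι a).Ω j) ∨ (∀ x, InBox (tlo L (z + e μ) j) (thi L (z + e μ) j) x → x ∈ (ι a).Ω j)) →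
        ‖(avgIter L (mulCfg U' U₀) j z μ : 𝔸) - (avgIter L U₀ j z μ : 𝔸)‖ ≤ α₁) →
      (∀ b ∈ {b : Site d × Fin d | SideTouches ((ι a).Ω 0) b.1 b.2}, ‖((U' b.1 b.2 : 𝔸ˣ) : 𝔸) - 1‖ ≤ α₁) →
      (∀ m, 1 ≤ m → m ≤ (ι a).k → ∀ (u : Site d → 𝔸ˣ) (W : Site d → Fin d → 𝔸ˣ) (A' : Site d → Fin d → 𝔸),
        (∀ x, u x ∈ unitaryUnits 𝔸) → mgauge U₀ u W = U' → Restr129 L m ((ι a).Λs m) U₀ u → LanF a U₀ φ m W →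
        (∀ y τ, IsSelfAdjoint (A' y τ)) →
        (∀ j, j ≤ m → ∀ y τ, SideTouches ((ι a).Ω j) y τ →
        W y τ = cfgExp (ι a).η A' y τ ∧ ‖A' y τ‖ ≤ (2 * (L * (5 * (d : ℝ) * L * B₈ * (α₀ + α₁))) + 8 * (8 * inp.B₀' * (5 * (d : ℝ) * L * B₈) * (α₀ + α₁))) * ((L : ℝ) ^ j * (ι a).η)⁻¹) →
        (∀ y τ, (∀ j, j ≤ m → ¬ SideTouches ((ι a).Ω j) y τ) → A' y τ = 0) →
        msup L m (ι a).η (-(1 : ℝ)) (fun j (b : Site d × Fin d) => SideTouches ((ι a).Ω j) b.1 b.2) (fun b => A' b.1 b.2)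
        ≤ inp.B₀ * (bondNorm L m (ι a).η (-(3 : ℝ)) (ι a).Ω (fun x μ => Jcur (ι a).η U₀ A' μ x)
        + wsup 1 (fun p : {p : ℕ × (Site d × Fin d) // p.1 ≤ m ∧ p.2 ∈ towerBondsP L (ι a).Ω ((ι a).Λs m) p.1} =>
        linCovIter L U₀ (iEta (ι a).η A') p.1.1 p.1.2.1 p.1.2.2)) + γ' * inp.B₀ * (α₀ + α₁) ∧
        msup L m (ι a).η (-(2 : ℝ)) (fun j (t : Fin d × Fin d × Site d) => SideTouches ((ι a).Ω j) t.2.2 t.2.1)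
        (fun t => covDerivFwd (ι a).η U₀ t.1 (fun z => A' z t.2.1) t.2.2)
        ≤ inp.B₀ * (bondNorm L m (ι a).η (-(3 : ℝ)) (ι a).Ω (fun x μ => Jcur (ι a).η U₀ A' μ x)
        + wsup 1 (fun p : {p : ℕ × (Site d × Fin d) // p.1 ≤ m ∧ p.2 ∈ towerBondsP L (ι a).Ω ((ι a).Λs m) p.1} =>
        linCovIter L U₀ (iEta (ι a).η A') p.1.1 p.1.2.1 p.1.2.2)) + γ' * inp.B₀ * (α₀ + α₁)))
    (SP5u : ∀ a : J, ∀ α₀ α₁ : ℝ, 0 < α₀ → 0 < α₁ → α₀ + α₁ ≤ cP →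
      ∀ U₀ U' : Site d → Fin d → 𝔸ˣ, (∀ x κ, U₀ x κ ∈ unitaryUnits 𝔸) → (∀ x κ, U' x κ ∈ unitaryUnits 𝔸) →
      ∀ φ : Φ, Adm a φ U₀ α₀ α₁ →
      InAk L (ι a).k (ι a).η α₀ (ι a).Ω U₀ → InAk L (ι a).k (ι a).η α₀ (ι a).Ω (mulCfg U' U₀) → (∀ m, m ≤ (ι a).k → InAx L m ((ι a).Λs m) U₀ (mulCfg U' U₀)) →
      (∀ j, j ≤ (ι a).k → ∀ (z : Site d) (μ : Fin d),
        ((∀ x, InBox (tlo L z j) (thi L z j) x → x ∈ (ι a).Ω j) ∨ (∀ x, InBox (tlo L (z + e μ) j) (thi L (z + e μ) j) x → x ∈ (ι a).Ω j)) →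
        ‖(avgIter L (mulCfg U' U₀) j z μ : 𝔸) - (avgIter L U₀ j z μ : 𝔸)‖ ≤ α₁) →
      (∀ b ∈ {b : Site d × Fin d | SideTouches ((ι a).Ω 0) b.1 b.2}, ‖((U' b.1 b.2 : 𝔸ˣ) : 𝔸) - 1‖ ≤ α₁) →
      ∀ u₁ : Site d → 𝔸ˣ, (∀ x, u₁ x ∈ unitaryUnits 𝔸) → (∀ x, x ∉ (ι a).Ω 0 → u₁ x = 1) → Restr129 L (ι a).k ((ι a).Λs (ι a).k) U₀ u₁ →
      LanF a U₀ φ (ι a).k (mgauge U₀ u₁⁻¹ U') →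
      (∃ A₁ : Site d → Fin d → 𝔸, ∀ j, j ≤ (ι a).k → ∀ (x : Site d) (κ : Fin d), SideTouches ((ι a).Ω j) x κ →
        mgauge U₀ u₁⁻¹ U' x κ = cfgExp (ι a).η A₁ x κ ∧ ‖A₁ x κ‖ ≤ (5 * (d : ℝ) * L * B₈ * (α₀ + α₁)) * ((L : ℝ) ^ j * (ι a).η)⁻¹) →
      ∀ (v w : Site d → 𝔸ˣ) (lam mu : Site d → 𝔸),
      (∀ x, ((gaugeExp lam x : 𝔸ˣ) : 𝔸) = ((v x : 𝔸ˣ) : 𝔸) ∧ IsSelfAdjoint (lam x) ∧ ‖lam x‖ < cu) → (∀ x, x ∉ (ι a).Ω 0 → lam x = 0) →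
      (∀ j, j ≤ (ι a).k → ∀ b ∈ {b : Site d × Fin d | SideTouches ((ι a).Ω j) b.1 b.2}, ((L : ℝ) ^ j * (ι a).η) * ‖covDerivFwd (ι a).η U₀ b.2 lam b.1‖ < cu) →
      (∀ x, ((gaugeExp mu x : 𝔸ˣ) : 𝔸) = ((w x : 𝔸ˣ) : 𝔸) ∧ IsSelfAdjoint (mu x) ∧ ‖mu x‖ < cu) → (∀ x, x ∉ (ι a).Ω 0 → mu x = 0) →
      (∀ j, j ≤ (ι a).k → ∀ b ∈ {b : Site d × Fin d | SideTouches ((ι a).Ω j) b.1 b.2}, ((L : ℝ) ^ j * (ι a).η) * ‖covDerivFwd (ι a).η U₀ b.2 mu b.1‖ < cu) →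
      LanF a U₀ φ (ι a).k (mgauge U₀ v⁻¹ (mgauge U₀ u₁⁻¹ U')) → Restr129 L (ι a).k ((ι a).Λs (ι a).k) U₀ (u₁ * v) →
      LanF a U₀ φ (ι a).k (mgauge U₀ w⁻¹ (mgauge U₀ u₁⁻¹ U')) → Restr129 L (ι a).k ((ι a).Λs (ι a).k) U₀ (u₁ * w) →
      ∀ x, v x = w x)
    (φ₀ : Φ) (hAdm₀ : ∀ a : J, ∀ α₀ α₁ : ℝ, 0 < α₀ → 0 < α₁ → ∀ U₀ : Site d → Fin d → 𝔸ˣ, (∀ x κ, U₀ x κ ∈ unitaryUnits 𝔸) →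
      Adm a φ₀ U₀ α₀ α₁)
    (hLan₀ : ∀ a : J, ∀ U₀ W : Site d → Fin d → 𝔸ˣ,
      LanF a U₀ φ₀ (ι a).k W ↔ IsLandau138W L (ι a).k (ι a).η ((ι a).Ω 0) ((ι a).Λs (ι a).k) U₀ W)
    (hΩ : ∀ a : J, (ι a).Ω 0 = Set.univ)
    (htw : ∀ a : J, ∀ m, m ≤ (ι a).k → ∀ j, j ≤ m → ∀ y ∈ (ι a).Λs m j, ∀ x, InBox (tlo L y j) (thi L y j) x → x ∈ (ι a).Ω j)
    -- PROPOSITION 3 AS PRINTED on the IMAGE family (dag-n05-d's `prop3Printed_zdGF3P_map_γ (ι)`; A6: not over all `ZdIdx`)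
    (hP3 : B8.Prop3Printed d (L : ℝ) C₂ inp B₀β (fun a : J => (zdGF3P₂ 𝔸 L β len (ι a)).toGFData2))
    {toAxial : ∀ a : J, (zdGF3HP₂ 𝔸 L β len (ι a)).Cfg → (zdGF3HP₂ 𝔸 L β len (ι a)).Pert → (zdGF3HP₂ 𝔸 L β len (ι a)).Pert}
    (p5e : B8.Prop5Exists inp.B₀' B₁ lan) (p5u : B8.Prop5Unique lan) (p6 : B8.Prop6Printed d (L : ℝ) B₁ c₁ cub)
    (p7 : B8Ineq145.Prop7RepairedC C₇ (fun a : J => zdGF3HP₂ 𝔸 L β len (ι a)) toAxial)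
    (t8 : B8Thm8Surviving.Thm8SurvivingAt 1 B₁ B₂ (fun a : J => zdGF3HP₂ 𝔸 L β len (ι a))) :
    B8LeafRSC d (L : ℝ) C₂ (5 * (d : ℝ) * L * B₈) inp.B₀' B₁ B₂ c₁ inp B₀β C₇ (blockPairNA d Lb 𝔸)
      (fun a : J => zdGF3HP₂ 𝔸 L β len (ι a)) lan cub toAxial where
  l1 := lemma1Printed_blockPairNA d Lb 𝔸
  t2 := thm2Printed_zdGF3HP₂_mapJ_γ' hd2 hL inp hB₀β hcu hcP hC₂ hγ' hB₈ hB₀8 hB hγB ι Adm LanF SP5base SP5 SH59src SP5u φ₀ hAdm₀ hLan₀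
    hΩ htw hP3
  p3 := hP3
  t4 := (thm4Printed_zdGF3HP₂_iff ι _).mpr (thm4Printed_zdGF3HP_mapJ_γ' hd2 hL inp.B₀_pos inp.B₀'_pos hcu hcP hγ' hB₈ hB₀8 hB hγB ι Adm LanF
    SP5base SP5 SH59src SP5u φ₀ hAdm₀ hLan₀ htw)
  p5e := p5e
  p5u := p5u
  p6 := p6
  p7 := p7
  t8 := t8

end Knit


end Literature.MathematicalPhysics.QuantumFieldTheory.Balaban1983to89.B8LeafKnitZdGF3P2GammaPrime

end
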